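import Literature.Analysis.FluidPDE.SpaceTimeMollifier
import Literature.Analysis.FluidPDE.KNSSLiouville
import Literature.Analysis.FluidPDE.PressurePoisson
import HarnessLib

/-!
# KNSS 2009, Lemma 3.1, step 1: space–time mollification of bounded weak solutions

Analysis/FluidPDE proofs file on the discharge path of the named facts
`KNSS2009_regularity_boundedWeak_ancient_planar` / `KNSS2009_weak_driftMild`
(Koch–Nadirashvili–Seregin–Šverák, Acta Math. 203 (2009) = arXiv:0709.3599v1, §3 **Lemma 3.1**:
a bounded weak solution `u` of the Stokes/Navier–Stokes system in `ℝⁿ × (0, T)` is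
`u = v + w + b(t)`, `v` the mild solution, `w` caloric, `b` bounded measurable; printed proof:
"Let `φ` be a mollifier … `u_ε = φ_ε ∗ u` (space–time convolution) … The (smooth and bounded)
function `h_ε = curl(u_ε − w_ε)` satisfies the heat equation … Liouville's theorem … compactness").
The tree proves Lemma 3.1 in the *drift-mild* form consumed by §4 (`IsDriftMildOn`,
`DriftMildBootstrap`) along the printed first step — **space–time mollification** — followed by
a duality argument with the caloric test fields `e^{(t−τ)Δ}φ` in place of the `curl`/compactness
argument (files `KNSSMollifiedDuality`, `KNSSLemma31`). This file is the mollification step for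
KNSS's class of **bounded weak solutions** (`IsBoundedWeakNSSolutionOn`, §4 (ii): solenoidal test
fields, no pressure): with a smooth kernel `k` supported in `closedBall 0 r` and the zero
extension `ũ = 𝟙_Q u` to space–time (`Q = I × E`, `I = (a, T)`),

* `V = k ⋆ ũ` (`stMollify k (zeroExt Q u)`) and the **mollified tensor**
  `W = k ⋆ (ũ ⊗ ũ)`, `(ũ ⊗ ũ)(t, x) = ⟪u, ·⟫u = rankOne ℝ u u ∈ E →L[ℝ] E` (`dyadField`, built on
  Mathlib's `InnerProductSpace.rankOne`), paired with gradients through the bundled Frobenius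
  pairing `frobeniusPairing E L T = ∑ᵢ ⟪L eᵢ, T eᵢ⟫` (so that
  `frobeniusPairing E (Dφ(x)) (u ⊗ u) = ⟪u, (u·∇)φ⟫`, `frobeniusPairing_rankOne_self`);
* the weak identity tested with the *correlated* test field `ψ = ǩ ⋆ Φ` of a space–time test
  field `Φ` with solenoidal slices (`ǩ(v) = k(−v)`; `ψ` is again a test field on `Q` with
  solenoidal slices when the time support of `Φ` keeps distance `r` from `∂I`, and its
  derivatives are `ǩ ⋆` of those of `Φ`), and the **adjoint identity**
  `∫ P(g, ǩ ⋆ H) = ∫ P(k ⋆ g, H)` (`integral_pair_stMollify_neg_eq`), give the **mollified weak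
  identity** `∫ (⟪V, ∂ₜΦ⟫ + frobeniusPairing(DₓΦ, W) + ν⟪V, ΔₓΦ⟫) = 0`
  (`IsBoundedWeakNSSolutionOn.integral_mollified_eq_zero`);
* the sup bound `‖(κ ⋆ g)(t, x)‖ ≤ ‖κ‖₁ C` for bounded data (`norm_stMollify_le_of_bound`).

The slice-by-slice form (`Φ = η ⊗ φ`, integration by parts in `t`, du Bois-Reymond) — the smooth
field `V` solves the linear Stokes system with the smooth bounded forcing tensor `W` against
solenoidal tests, the form in which KNSS's Lemma 3.1 is applied to `u_ε` — is the sibling file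
`KNSSMollifiedSlice`. Everything here is proved, in any finite-dimensional `E` and for every
viscosity `ν`.

refactor (for the librarian): `frobeniusPairing E` is the bundled (`→L[ℝ]` in both arguments)
form of the unbundled `frobeniusInner` of `PeriodicLeraySystem` (same formula `∑ᵢ ⟪A eᵢ, B eᵢ⟫`),
which is not in this file's import closure; `frobeniusInner` belongs next to `frobeniusNormSq` in
`VectorCalculus`, after which `frobeniusPairing E A B = frobeniusInner A B` is `rfl`-adjacent
(here only the diagonal bridge `frobeniusPairing_self` to `frobeniusNormSq` is proved).

## References

* G. Koch, N. Nadirashvili, G. Seregin, V. Šverák, *Liouville theorems for the Navier–Stokes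
  equations and applications*, Acta Math. 203 (2009) 83–105 = arXiv:0709.3599v1: §3 p. 7
  (weak solutions of the Stokes system; Lemma 3.1 and its proof), §4 (ii) p. 8.
  [KochNadirashviliSereginSverak2009]
* L. C. Evans, *Partial Differential Equations*, 2nd ed. (2010), App. C.4 (mollifiers).
-/

noncomputable section

open MeasureTheory TopologicalSpace Set Function Filter ContinuousLinearMap Metric
  InnerProductSpace
open _root_.Topology
open scoped ENNReal NNReal Convolution Laplacian RealInnerProductSpace ContDiff

namespace Literature.Analysis.FluidPDE

variable {E : Type*} [NormedAddCommGroup E] [InnerProductSpace ℝ E] [FiniteDimensional ℝ E]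
  [MeasurableSpace E] [BorelSpace E]
variable {F : Type*} [NormedAddCommGroup F] [NormedSpace ℝ F]

/-- Lebesgue measure on space–time `ℝ × E` is an additive Haar measure (as in
`SpaceTimeMollifier`). [folklore] -/
local instance instIsAddHaarMeasureVolumeSpaceTimeKNSS :
    (volume : Measure (ℝ × E)).IsAddHaarMeasure :=
  Measure.prod.instIsAddHaarMeasure _ _

/-! ### The rank-one tensor `u ⊗ u` and its pairing with gradients -/

section Tensor

/-- The **dyad field** `(t, x) ↦ u(t,x) ⊗ u(t,x) = ⟪u, ·⟫ u ∈ E →L[ℝ] E` of a velocity field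
(the matrix `(uᵢuⱼ)`, KNSS's `u_k u` in `f_k = −u_k u`, §4 p. 8), as Mathlib's rank-one operator
`InnerProductSpace.rankOne ℝ u u` (`rankOne_apply`, `norm_rankOne : ‖rankOne ℝ a a‖ = ‖a‖²`).
[cite: KochNadirashviliSereginSverak2009, §4 (ii) p. 8 (arXiv:0709.3599v1)] -/
def dyadField (u : ℝ → E → E) : ℝ → E → E →L[ℝ] E :=
  fun t x => rankOne ℝ (u t x) (u t x)

omit [FiniteDimensional ℝ E] [MeasurableSpace E] [BorelSpace E] in
/-- Unfolding `dyadField`. [folklore] -/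
@[simp]
theorem dyadField_apply (u : ℝ → E → E) (t : ℝ) (x v : E) :
    dyadField u t x v = ⟪u t x, v⟫ • u t x := rfl

omit [FiniteDimensional ℝ E] [MeasurableSpace E] [BorelSpace E] in
/-- `a ↦ a ⊗ a = rankOne ℝ a a` is continuous (the rank-one operator is a bundled continuous
sesquilinear map). [folklore] -/
theorem continuous_rankOne_self : Continuous fun a : E => rankOne ℝ a a :=
  (rankOne ℝ (E := E) (F := E)).continuous₂.comp (continuous_id.prodMk continuous_id)

variable (E) in
/-- The **bundled Frobenius pairing** of operators: `frobeniusPairing E L T = ∑ᵢ ⟪L eᵢ, T eᵢ⟫`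
over the standard orthonormal frame `e = stdOrthonormalBasis ℝ E` (the contraction `∂ⱼφᵢ Tᵢⱼ`;
for `T = u ⊗ u` and `L = Dφ(x)` it is `⟪u, (u·∇)φ⟫`, the nonlinear density of KNSS's weak
formulation, §4 (ii)), as a continuous bilinear form — the bundled form of the (unbundled)
`frobeniusInner` of `PeriodicLeraySystem` (same formula), with `frobeniusPairing E L L =
frobeniusNormSq L` (`frobeniusPairing_self`). [cite: KochNadirashviliSereginSverak2009, §4 (ii) p. 8 (arXiv:0709.3599v1)] -/
def frobeniusPairing : (E →L[ℝ] E) →L[ℝ] (E →L[ℝ] E) →L[ℝ] ℝ :=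
  ∑ i, (innerSL ℝ : E →L[ℝ] E →L[ℝ] ℝ).bilinearComp
    (ContinuousLinearMap.apply ℝ E (stdOrthonormalBasis ℝ E i))
    (ContinuousLinearMap.apply ℝ E (stdOrthonormalBasis ℝ E i))

omit [MeasurableSpace E] [BorelSpace E] in
/-- Unfolding `frobeniusPairing`. [folklore] -/
theorem frobeniusPairing_apply (L T : E →L[ℝ] E) :
    frobeniusPairing E L T = ∑ i, ⟪L (stdOrthonormalBasis ℝ E i), T (stdOrthonormalBasis ℝ E i)⟫ := by
  simp only [frobeniusPairing, FunLike.coe_sum, Finset.sum_apply, bilinearComp_apply,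
    ContinuousLinearMap.apply_apply, innerSL_apply_apply]

omit [MeasurableSpace E] [BorelSpace E] in
/-- The diagonal bridge to the squared Frobenius norm of `VectorCalculus`:
`frobeniusPairing E L L = frobeniusNormSq L`. [folklore] -/
theorem frobeniusPairing_self (L : E →L[ℝ] E) : frobeniusPairing E L L = frobeniusNormSq L := by
  rw [frobeniusPairing_apply, frobeniusNormSq]
  exact Finset.sum_congr rfl fun i _ => real_inner_self_eq_norm_sq _

omit [MeasurableSpace E] [BorelSpace E] in
/-- A nonnegative continuity constant of the Frobenius pairing:
`‖frobeniusPairing E L T‖ ≤ C ‖L‖ ‖T‖` (its operator norm, named abstractly). [folklore] -/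
theorem exists_norm_frobeniusPairing_le :
    ∃ C, 0 ≤ C ∧ ∀ L T : E →L[ℝ] E, ‖frobeniusPairing E L T‖ ≤ C * ‖L‖ * ‖T‖ := by
  obtain ⟨C, hC⟩ : ∃ C, ∀ L T : E →L[ℝ] E, ‖frobeniusPairing E L T‖ ≤ C * ‖L‖ * ‖T‖ :=
    ⟨_, (frobeniusPairing E).le_opNorm₂⟩
  exact ⟨max C 0, le_max_right _ _, fun L T => (hC L T).trans (by gcongr; exact le_max_left _ _)⟩

omit [MeasurableSpace E] [BorelSpace E] in
/-- **The nonlinear density**: `frobeniusPairing E (Dφ(x)) (a ⊗ a) = ⟪a, Dφ(x) a⟫` (expand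
`a = ∑ᵢ ⟪a, eᵢ⟫ eᵢ` inside `Dφ(x)`). [cite: KochNadirashviliSereginSverak2009, §4 (ii) p. 8 (arXiv:0709.3599v1)] -/
theorem frobeniusPairing_rankOne_self (L : E →L[ℝ] E) (a : E) :
    frobeniusPairing E L (rankOne ℝ a a) = ⟪a, L a⟫ := by
  rw [frobeniusPairing_apply]
  simp only [rankOne_apply, inner_smul_right]
  have h : ∀ i, ⟪a, stdOrthonormalBasis ℝ E i⟫ * ⟪L (stdOrthonormalBasis ℝ E i), a⟫ =
      ⟪a, L (⟪stdOrthonormalBasis ℝ E i, a⟫ • stdOrthonormalBasis ℝ E i)⟫ := fun i => by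
    rw [map_smul, inner_smul_right, real_inner_comm a (L _), real_inner_comm a]
  simp_rw [h]
  rw [← inner_sum, ← map_sum, (stdOrthonormalBasis ℝ E).sum_repr' a]

end Tensor

/-! ### Mollifying smooth compactly supported data: derivatives fall on the data, supports -/

section TestData

variable {κ : ℝ × E → ℝ} {H : ℝ × E → F}

/-- **Derivatives fall on smooth compactly supported data**: for a locally integrable kernel `κ`
and `H ∈ C_c^∞(ℝ × E; F)`, `D(κ ⋆ H)(z) V = (κ ⋆ (DH · V))(z)` (Mathlib's
`HasCompactSupport.hasFDerivAt_convolution_right`, evaluated). [folklore] -/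
theorem fderiv_convolution_lsmul_right_apply (hκ : LocallyIntegrable κ volume)
    (hH : ContDiff ℝ ∞ H) (hHc : HasCompactSupport H) (z V : ℝ × E) :
    fderiv ℝ (κ ⋆[lsmul ℝ ℝ, volume] H) z V =
      (κ ⋆[lsmul ℝ ℝ, volume] fun w => fderiv ℝ H w V) z := by
  have hH1 : ContDiff ℝ 1 H := hH.of_le (by exact_mod_cast le_top)
  have hD := hHc.hasFDerivAt_convolution_right (lsmul ℝ ℝ) hκ hH1 z
  have hint := (hHc.fderiv ℝ).convolutionExists_right
    ((lsmul ℝ ℝ : ℝ →L[ℝ] F →L[ℝ] F).precompR (ℝ × E)) hκ (hH.continuous_fderiv (by simp)) z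
  rw [hD.fderiv, convolution_def, ContinuousLinearMap.integral_apply hint.integrable V, convolution_def]
  rfl

omit [FiniteDimensional ℝ E] [MeasurableSpace E] [BorelSpace E] in
/-- For a smooth `Φ : ℝ → E → F`, `D(uncurry Φ)(w)(1, 0) = ∂ₜΦ w`. [folklore] -/
theorem fderiv_uncurry_apply_one_zero {Φ : ℝ → E → F} (hΦ : ContDiff ℝ ∞ (uncurry Φ)) :
    (fun w => fderiv ℝ (uncurry Φ) w (1, 0)) = uncurry (timeDeriv Φ) := by
  funext w
  have hdw : DifferentiableAt ℝ (uncurry Φ) w := (hΦ.differentiable (by simp)) w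
  rw [show Φ = curry (uncurry Φ) from rfl, uncurry_curry]
  exact (timeDeriv_curry_eq_fderiv hdw).symm

omit [FiniteDimensional ℝ E] [MeasurableSpace E] [BorelSpace E] in
/-- For a smooth `Φ : ℝ → E → F`, `D(uncurry Φ)(w)(0, v) = DₓΦ w v`. [folklore] -/
theorem fderiv_uncurry_apply_zero {Φ : ℝ → E → F} (hΦ : ContDiff ℝ ∞ (uncurry Φ)) (v : E) :
    (fun w => fderiv ℝ (uncurry Φ) w (0, v)) = uncurry fun s y => fderiv ℝ (Φ s) y v := by
  funext w
  have hdw : DifferentiableAt ℝ (uncurry Φ) w := (hΦ.differentiable (by simp)) w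
  change fderiv ℝ (uncurry Φ) w (0, v) = fderiv ℝ (Φ w.1) w.2 v
  rw [show Φ w.1 = fun y => uncurry Φ (w.1, y) from rfl, fderiv_slice_apply hdw]

/-- Time derivative on the data: `∂ₜ(κ ⋆ Φ) = κ ⋆ (∂ₜΦ)` for a space–time test field `Φ`.
[folklore] -/
theorem timeDeriv_stMollify_of_hasCompactSupport (hκ : LocallyIntegrable κ volume) {Φ : ℝ → E → F}
    (hΦ : ContDiff ℝ ∞ (uncurry Φ)) (hΦc : HasCompactSupport (uncurry Φ)) (t : ℝ) (x : E) :
    timeDeriv (stMollify κ (uncurry Φ)) t x = stMollify κ (uncurry (timeDeriv Φ)) t x := by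
  have hd : DifferentiableAt ℝ (κ ⋆[lsmul ℝ ℝ, volume] uncurry Φ) (t, x) :=
    ((hΦc.contDiff_convolution_right (lsmul ℝ ℝ) hκ hΦ).differentiable (by simp)) _
  rw [stMollify, timeDeriv_curry_eq_fderiv hd, fderiv_convolution_lsmul_right_apply hκ hΦ hΦc,
    fderiv_uncurry_apply_one_zero hΦ]
  rfl

/-- Spatial derivative on the data: `Dₓ(κ ⋆ Φ)(t, ·)(x) v = (κ ⋆ (DₓΦ · v))(t, x)`. [folklore] -/
theorem fderiv_stMollify_apply_of_hasCompactSupport (hκ : LocallyIntegrable κ volume) {Φ : ℝ → E → F}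
    (hΦ : ContDiff ℝ ∞ (uncurry Φ)) (hΦc : HasCompactSupport (uncurry Φ)) (t : ℝ) (x v : E) :
    fderiv ℝ (stMollify κ (uncurry Φ) t) x v =
      stMollify κ (uncurry fun s y => fderiv ℝ (Φ s) y v) t x := by
  have hd : DifferentiableAt ℝ (κ ⋆[lsmul ℝ ℝ, volume] uncurry Φ) (t, x) :=
    ((hΦc.contDiff_convolution_right (lsmul ℝ ℝ) hκ hΦ).differentiable (by simp)) _
  change fderiv ℝ (fun y => (κ ⋆[lsmul ℝ ℝ, volume] uncurry Φ) (t, y)) x v = _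
  rw [fderiv_slice_apply hd, fderiv_convolution_lsmul_right_apply hκ hΦ hΦc,
    fderiv_uncurry_apply_zero hΦ v]
  rfl

omit [FiniteDimensional ℝ E] [MeasurableSpace E] [BorelSpace E] in
/-- `w ↦ Dg(w) V` is smooth for smooth `g`. [folklore] -/
theorem contDiff_fderiv_apply_const_vec {g : ℝ × E → F} (hg : ContDiff ℝ ∞ g) (V : ℝ × E) :
    ContDiff ℝ ∞ fun w => fderiv ℝ g w V :=
  (hg.fderiv_right (m := ∞) (by exact_mod_cast le_rfl)).clm_apply contDiff_const

omit [FiniteDimensional ℝ E] [MeasurableSpace E] [BorelSpace E] in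
/-- The spatial directional derivative of a space–time test field along a fixed vector is again a
smooth compactly supported field, with uncurrying given by `D(uncurry Φ)(·)(0, v)`. [folklore] -/
theorem contDiff_hasCompactSupport_fderiv_slice {Φ : ℝ → E → F} (hΦ : ContDiff ℝ ∞ (uncurry Φ))
    (hΦc : HasCompactSupport (uncurry Φ)) (v : E) :
    ContDiff ℝ ∞ (uncurry fun s y => fderiv ℝ (Φ s) y v) ∧
      HasCompactSupport (uncurry fun s y => fderiv ℝ (Φ s) y v) := by
  rw [← fderiv_uncurry_apply_zero hΦ v]
  exact ⟨contDiff_fderiv_apply_const_vec hΦ _, (hΦc.fderiv ℝ).mono fun w hw h0 =>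
    hw (by change fderiv ℝ (uncurry Φ) w (0, v) = 0; rw [h0]; rfl)⟩

omit [FiniteDimensional ℝ E] [MeasurableSpace E] [BorelSpace E] in
/-- The time derivative of a space–time test field is again smooth with compact support.
[folklore] -/
theorem contDiff_hasCompactSupport_timeDeriv {Φ : ℝ → E → F} (hΦ : ContDiff ℝ ∞ (uncurry Φ))
    (hΦc : HasCompactSupport (uncurry Φ)) :
    ContDiff ℝ ∞ (uncurry (timeDeriv Φ)) ∧ HasCompactSupport (uncurry (timeDeriv Φ)) := by
  rw [← fderiv_uncurry_apply_one_zero hΦ]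
  exact ⟨contDiff_fderiv_apply_const_vec hΦ _, (hΦc.fderiv ℝ).mono fun w hw h0 =>
    hw (by change fderiv ℝ (uncurry Φ) w (1, 0) = 0; rw [h0]; rfl)⟩

/-- **Linearity of the mollification in the data over finite sums** (compactly supported
continuous data, locally integrable kernel). [folklore] -/
theorem stMollify_finset_sum {ι : Type*} (hκ : LocallyIntegrable κ volume) (S : Finset ι)
    {g : ι → ℝ × E → F} (hg : ∀ i ∈ S, Continuous (g i)) (hgc : ∀ i ∈ S, HasCompactSupport (g i))
    (t : ℝ) (x : E) :
    stMollify κ (fun w => ∑ i ∈ S, g i w) t x = ∑ i ∈ S, stMollify κ (g i) t x := by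
  simp only [stMollify_apply, convolution_def, lsmul_apply, Finset.smul_sum]
  exact integral_finsetSum S fun i hi =>
    ((hgc i hi).convolutionExists_right (lsmul ℝ ℝ : ℝ →L[ℝ] F →L[ℝ] F) hκ (hg i hi) (t, x)).integrable

omit [FiniteDimensional ℝ E] [MeasurableSpace E] [BorelSpace E] in
/-- The iterated spatial directional derivative `∂ᵥ∂ᵥ` of a smooth slice equals
`D²φ(x)[v, v]` written as `D(D φ · v)(x) v`. [folklore] -/
theorem iteratedFDeriv_two_apply_self {φ : E → F} (hφ : ContDiff ℝ 2 φ) (x v : E) :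
    iteratedFDeriv ℝ 2 φ x ![v, v] = fderiv ℝ (fun y => fderiv ℝ φ y v) x v := by
  have hd : DifferentiableAt ℝ (fderiv ℝ φ) x :=
    ((hφ.fderiv_right (m := 1) le_rfl).differentiable one_ne_zero) x
  rw [iteratedFDeriv_two_apply, fderiv_clm_apply hd (differentiableAt_const v)]
  simp

/-- **Laplacian on the data**: `Δₓ(κ ⋆ Φ)(t, ·)(x) = (κ ⋆ (ΔₓΦ))(t, x)` for a space–time test field
`Φ` and a locally integrable kernel (pure second derivatives twice on the data, summed over an
orthonormal frame). [folklore] -/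
theorem laplacian_stMollify_of_hasCompactSupport [CompleteSpace F] (hκ : LocallyIntegrable κ volume)
    {Φ : ℝ → E → F} (hΦ : ContDiff ℝ ∞ (uncurry Φ)) (hΦc : HasCompactSupport (uncurry Φ))
    (t : ℝ) (x : E) :
    (Δ (stMollify κ (uncurry Φ) t)) x = stMollify κ (uncurry fun s y => (Δ (Φ s)) y) t x := by
  set b := stdOrthonormalBasis ℝ E with hb
  have hψ : ContDiff ℝ ∞ (stMollify κ (uncurry Φ) t) :=
    contDiff_slice (hΦc.contDiff_convolution_right (lsmul ℝ ℝ) hκ hΦ) t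
  -- first derivatives on the data, as functions of `y`
  have h1 : ∀ i, (fun y => fderiv ℝ (stMollify κ (uncurry Φ) t) y (b i)) =
      stMollify κ (uncurry fun s y => fderiv ℝ (Φ s) y (b i)) t := fun i =>
    funext fun y => fderiv_stMollify_apply_of_hasCompactSupport hκ hΦ hΦc t y (b i)
  -- second derivatives
  have h2 : ∀ i, fderiv ℝ (fun y => fderiv ℝ (stMollify κ (uncurry Φ) t) y (b i)) x (b i) =
      stMollify κ (uncurry fun s y => fderiv ℝ (fun y' => fderiv ℝ (Φ s) y' (b i)) y (b i)) t x :=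
    fun i => by
    obtain ⟨hc, hcs⟩ := contDiff_hasCompactSupport_fderiv_slice hΦ hΦc (b i)
    rw [h1 i, fderiv_stMollify_apply_of_hasCompactSupport hκ hc hcs t x (b i)]
  -- the slices of `Φ` are `C²`
  have hΦs : ∀ s, ContDiff ℝ 2 (Φ s) := fun s => contDiff_infty.1 (contDiff_slice hΦ s) 2
  have hψ2 : ContDiff ℝ 2 (stMollify κ (uncurry Φ) t) := contDiff_infty.1 hψ 2
  have h3 : ∀ i, iteratedFDeriv ℝ 2 (stMollify κ (uncurry Φ) t) x ![b i, b i] =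
      stMollify κ (uncurry fun s y => fderiv ℝ (fun y' => fderiv ℝ (Φ s) y' (b i)) y (b i)) t x :=
    fun i => by rw [iteratedFDeriv_two_apply_self hψ2, h2 i]
  rw [laplacian_eq_iteratedFDeriv_orthonormalBasis (stMollify κ (uncurry Φ) t) b]
  simp only []
  rw [Finset.sum_congr rfl fun i _ => h3 i, ← stMollify_finset_sum hκ]
  · congr 1
    funext w
    change (∑ i, fderiv ℝ (fun y' => fderiv ℝ (Φ w.1) y' (b i)) w.2 (b i)) = (Δ (Φ w.1)) w.2
    rw [laplacian_eq_iteratedFDeriv_orthonormalBasis (Φ w.1) b]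
    exact Finset.sum_congr rfl fun i _ => (iteratedFDeriv_two_apply_self (hΦs w.1) w.2 (b i)).symm
  · intro i _
    obtain ⟨hc, hcs⟩ := contDiff_hasCompactSupport_fderiv_slice hΦ hΦc (b i)
    exact (contDiff_hasCompactSupport_fderiv_slice hc hcs (b i)).1.continuous
  · intro i _
    obtain ⟨hc, hcs⟩ := contDiff_hasCompactSupport_fderiv_slice hΦ hΦc (b i)
    exact (contDiff_hasCompactSupport_fderiv_slice hc hcs (b i)).2

/-- **Divergence on the data**: the slices of `κ ⋆ Φ` are divergence free when those of the
space–time test field `Φ` are (the divergence is `κ ⋆ (div Φ) = 0`). [folklore] -/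
theorem isDivFree_stMollify_of_hasCompactSupport (hκ : LocallyIntegrable κ volume)
    {Φ : ℝ → E → E} (hΦ : ContDiff ℝ ∞ (uncurry Φ)) (hΦc : HasCompactSupport (uncurry Φ))
    (hdiv : ∀ s, VectorCalculus.IsDivFree (Φ s)) (t : ℝ) :
    VectorCalculus.IsDivFree (stMollify κ (uncurry Φ) t) := by
  set b := stdOrthonormalBasis ℝ E with hb
  intro x
  rw [divergence_eq_sum_inner_fderiv b]
  have h1 : ∀ i, ⟪b i, fderiv ℝ (stMollify κ (uncurry Φ) t) x (b i)⟫ =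
      stMollify κ (fun w => ⟪b i, (uncurry fun s y => fderiv ℝ (Φ s) y (b i)) w⟫) t x := fun i => by
    obtain ⟨hc, hcs⟩ := contDiff_hasCompactSupport_fderiv_slice hΦ hΦc (b i)
    rw [fderiv_stMollify_apply_of_hasCompactSupport hκ hΦ hΦc t x (b i), real_inner_comm,
      stMollify_apply, inner_convolution_lsmul_apply
        ((hcs.convolutionExists_right (lsmul ℝ ℝ : ℝ →L[ℝ] E →L[ℝ] E) hκ hc.continuous) (t, x)) (b i)]
    simp only [stMollify_apply, real_inner_comm (b i)]
  simp only [h1]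
  rw [← stMollify_finset_sum hκ]
  · have hzero : (fun w : ℝ × E => ∑ i, ⟪b i, (uncurry fun s y => fderiv ℝ (Φ s) y (b i)) w⟫) = 0 := by
      funext w
      change (∑ i, ⟪b i, fderiv ℝ (Φ w.1) w.2 (b i)⟫) = 0
      rw [← divergence_eq_sum_inner_fderiv b]
      exact hdiv w.1 w.2
    rw [hzero]
    simp [stMollify_eq_integral]
  · intro i _
    obtain ⟨hc, -⟩ := contDiff_hasCompactSupport_fderiv_slice hΦ hΦc (b i)
    exact continuous_const.inner hc.continuous
  · intro i _
    obtain ⟨-, hcs⟩ := contDiff_hasCompactSupport_fderiv_slice hΦ hΦc (b i)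
    refine hcs.mono fun w hw h0 => hw ?_
    change ⟪b i, fderiv ℝ (Φ w.1) w.2 (b i)⟫ = 0
    rw [show fderiv ℝ (Φ w.1) w.2 (b i) = 0 from h0, inner_zero_right]

/-- **The correlated test field is a space–time test field on the slab.** If `κ` is continuous and
vanishes outside `closedBall 0 r`, `Φ` is smooth with compact support and `Φ(s, ·) = 0` for
`s ∉ [t₁, t₂]`, and `a < t₁ − r`, `t₂ + r < T`, then `κ ⋆ Φ` is a space–time test field on the
slab `(a, T) × E` (smooth; compact support `⊆ tsupport Φ + tsupport κ`; it vanishes for times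
outside `[t₁ − r, t₂ + r]`, the norm on `ℝ × E` being the sup norm). [folklore] -/
theorem isSpaceTimeTestOn_stMollify_of_time_support {κ : ℝ × E → ℝ} (hκ : Continuous κ) {r : ℝ}
    (hκr : ∀ w, w ∉ closedBall (0 : ℝ × E) r → κ w = 0) {Φ : ℝ → E → F}
    (hΦ : ContDiff ℝ ∞ (uncurry Φ)) (hΦc : HasCompactSupport (uncurry Φ)) {t₁ t₂ a T : ℝ}
    (hΦt : ∀ s, s ∉ Icc t₁ t₂ → ∀ y, Φ s y = 0) (ha : a < t₁ - r) (hT : t₂ + r < T) :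
    IsSpaceTimeTestOn (slab E (Ioo a T) isOpen_Ioo) (stMollify κ (uncurry Φ)) ∧
      ∀ s, s ∉ Icc (t₁ - r) (t₂ + r) → ∀ y, stMollify κ (uncurry Φ) s y = 0 := by
  have hκc : HasCompactSupport κ := hasCompactSupport_of_closedBall hκr
  have hκl : LocallyIntegrable κ volume := hκ.locallyIntegrable
  -- vanishing for times far from the time support of `Φ`
  have hvan : ∀ s, s ∉ Icc (t₁ - r) (t₂ + r) → ∀ y, stMollify κ (uncurry Φ) s y = 0 := by
    intro s hs y
    rw [stMollify_eq_integral]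
    refine integral_eq_zero_of_ae (Eventually.of_forall fun w => ?_)
    change κ ((s, y) - w) • uncurry Φ w = 0
    by_cases hw : w.1 ∈ Icc t₁ t₂
    · have hfar : ((s, y) : ℝ × E) - w ∉ closedBall (0 : ℝ × E) r := by
        intro hmem
        rw [mem_closedBall, dist_zero_right] at hmem
        have h1 : |s - w.1| ≤ r := (norm_fst_le ((s, y) - w)).trans hmem
        rw [abs_le] at h1
        exact hs ⟨by linarith [hw.1, h1.2], by linarith [hw.2, h1.1]⟩
      rw [hκr _ hfar, zero_smul]
    · rw [show uncurry Φ w = Φ w.1 w.2 from rfl, hΦt w.1 hw w.2, smul_zero]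
  refine ⟨⟨hΦc.contDiff_convolution_right (lsmul ℝ ℝ) hκl hΦ, hκc.convolution (lsmul ℝ ℝ) hΦc, ?_⟩,
    hvan⟩
  -- the support lies in the closed strip `[t₁ − r, t₂ + r] × E ⊆ (a, T) × E`
  have hsupp : support (uncurry (stMollify κ (uncurry Φ))) ⊆ Icc (t₁ - r) (t₂ + r) ×ˢ univ := by
    intro w hw
    refine ⟨?_, mem_univ _⟩
    by_contra h
    exact hw (hvan w.1 h w.2)
  have hcl : IsClosed (Icc (t₁ - r) (t₂ + r) ×ˢ (univ : Set E)) := isClosed_Icc.prod isClosed_univ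
  refine (closure_minimal hsupp hcl).trans ?_
  rintro ⟨s, y⟩ ⟨hs, -⟩
  rw [SetLike.mem_coe, mem_slab]
  exact ⟨by linarith [hs.1], by linarith [hs.2]⟩

end TestData

/-! ### The adjoint identity for space–time mollification -/

section Adjoint

variable {F₁ F₂ : Type*} [NormedAddCommGroup F₁] [NormedSpace ℝ F₁] [NormedAddCommGroup F₂]
  [NormedSpace ℝ F₂] [CompleteSpace F₁] [CompleteSpace F₂]

/-- **Adjoint identity** `∫ P(g(w), (ǩ ⋆ H)(w)) dw = ∫ P((k ⋆ g)(z), H(z)) dz` for a continuous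
bilinear form `P`, a continuous compactly supported kernel `k` (`ǩ(v) = k(−v)`), a bounded
measurable field `g` and a continuous compactly supported field `H` (Fubini on
`(w, z) ↦ k(z − w) P(g(w), H(z))`, which is bounded and supported in a compact set). This is the
passage "`∫∫ u (φ_ε ∗̌ Φ) = ∫∫ (φ_ε ∗ u) Φ`" in the mollification of a weak formulation
(Evans, *PDE*, App. C.4). [folklore] -/
theorem integral_pair_stMollify_neg_eq (P : F₁ →L[ℝ] F₂ →L[ℝ] ℝ) {k : ℝ × E → ℝ}
    (hk : Continuous k) (hkc : HasCompactSupport k) {g : ℝ × E → F₁}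
    (hg : AEStronglyMeasurable g volume) {C : ℝ} (hC : ∀ w, ‖g w‖ ≤ C) {H : ℝ × E → F₂}
    (hH : Continuous H) (hHc : HasCompactSupport H) :
    ∫ w, P (g w) (stMollify (fun v => k (-v)) H w.1 w.2) = ∫ z, P (stMollify k g z.1 z.2) (H z) := by
  -- the double integrand
  set G : ℝ × E → ℝ × E → ℝ := fun w z => k (z - w) * P (g w) (H z) with hG
  obtain ⟨Ck, hCk⟩ := hk.bounded_above_of_compact_support hkc
  obtain ⟨CH, hCH⟩ := hH.bounded_above_of_compact_support hHc
  have hC0 : 0 ≤ C := (norm_nonneg _).trans (hC 0)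
  have hCk0 : 0 ≤ Ck := (norm_nonneg _).trans (hCk 0)
  have hCH0 : 0 ≤ CH := (norm_nonneg _).trans (hCH 0)
  -- compact support of the double integrand
  set Kz : Set (ℝ × E) := tsupport H with hKz
  set Kw : Set (ℝ × E) := (fun p : (ℝ × E) × (ℝ × E) => p.1 - p.2) '' (Kz ×ˢ tsupport k) with hKw
  have hKzc : IsCompact Kz := hHc
  have hKwc : IsCompact Kw := (hKzc.prod hkc).image (continuous_fst.sub continuous_snd)
  have hGsupp : ∀ w z, G w z ≠ 0 → w ∈ Kw ∧ z ∈ Kz := by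
    intro w z hne
    have hz : z ∈ Kz := subset_tsupport _ (fun h => hne (by simp [hG, h]))
    have hkz : z - w ∈ tsupport k := subset_tsupport _ (fun h => hne (by simp [hG, h]))
    exact ⟨⟨(z, z - w), ⟨hz, hkz⟩, by simp⟩, hz⟩
  have hGbd : ∀ w z, ‖G w z‖ ≤ Ck * (‖P‖ * C * CH) := by
    intro w z
    simp only [hG, norm_mul]
    refine mul_le_mul (hCk _) ?_ (norm_nonneg _) hCk0
    calc ‖P (g w) (H z)‖ ≤ ‖P‖ * ‖g w‖ * ‖H z‖ := P.le_opNorm₂ _ _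
      _ ≤ ‖P‖ * C * CH := by gcongr; exacts [hC w, hCH z]
  have hGm : AEStronglyMeasurable (uncurry G) ((volume : Measure (ℝ × E)).prod volume) := by
    refine AEStronglyMeasurable.mul ?_ ?_
    · exact (hk.comp (continuous_snd.sub continuous_fst)).aestronglyMeasurable
    · have h1 : AEStronglyMeasurable (fun q : (ℝ × E) × (ℝ × E) => g q.1) (volume.prod volume) :=
        hg.comp_quasiMeasurePreserving Measure.quasiMeasurePreserving_fst
      have h2 : AEStronglyMeasurable (fun q : (ℝ × E) × (ℝ × E) => H q.2) (volume.prod volume) :=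
        (hH.comp continuous_snd).aestronglyMeasurable
      exact P.isBoundedBilinearMap.continuous.comp_aestronglyMeasurable (h1.prodMk h2)
  have hGint : Integrable (uncurry G) ((volume : Measure (ℝ × E)).prod volume) := by
    have hS : IsCompact (Kw ×ˢ Kz) := hKwc.prod hKzc
    refine Integrable.mono' ((integrableOn_const (C := Ck * (‖P‖ * C * CH)) (hs := hS.measure_lt_top.ne)
      ).integrable_indicator (hS.isClosed.measurableSet)) hGm (Eventually.of_forall fun q => ?_)
    by_cases hq : uncurry G q = 0
    · rw [hq, norm_zero]; exact indicator_nonneg (fun _ _ => by positivity) _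
    · have hmem : q ∈ Kw ×ˢ Kz := by
        obtain ⟨h1, h2⟩ := hGsupp q.1 q.2 hq
        exact ⟨h1, h2⟩
      rw [indicator_of_mem hmem]
      exact hGbd q.1 q.2
  -- left-hand side as an iterated integral
  have hL : ∀ w, P (g w) (stMollify (fun v => k (-v)) H w.1 w.2) = ∫ z, G w z := by
    intro w
    rw [stMollify_eq_integral]
    have hint : Integrable (fun z => k (z - w) • H z) (volume : Measure (ℝ × E)) := by
      refine (hH.integrable_of_hasCompactSupport hHc).norm.const_mul Ck |>.mono' ?_
        (Eventually.of_forall fun z => ?_)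
      · exact ((hk.comp (continuous_id.sub continuous_const)).smul hH).aestronglyMeasurable
      · rw [norm_smul]; exact mul_le_mul_of_nonneg_right (hCk _) (norm_nonneg _)
    have : (fun z : ℝ × E => k (-((w.1, w.2) - z)) • H z) = fun z => k (z - w) • H z := by
      funext z; rw [neg_sub]
    rw [this, ← (P (g w)).integral_comp_comm hint]
    refine integral_congr_ae (Eventually.of_forall fun z => ?_)
    simp only [hG, map_smul, smul_eq_mul]
  -- right-hand side as an iterated integral
  have hR : ∀ z, P (stMollify k g z.1 z.2) (H z) = ∫ w, G w z := by
    intro z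
    rw [stMollify_eq_integral]
    have hint : Integrable (fun w => k ((z.1, z.2) - w) • g w) (volume : Measure (ℝ × E)) := by
      have hkc' : HasCompactSupport (fun w : ℝ × E => k ((z.1, z.2) - w)) :=
        hkc.comp_homeomorph (Homeomorph.subLeft ((z.1, z.2) : ℝ × E))
      have hki : Integrable (fun w : ℝ × E => k ((z.1, z.2) - w)) volume :=
        (hk.comp (continuous_const.sub continuous_id)).integrable_of_hasCompactSupport hkc'
      refine (hki.norm.mul_const C).mono' ?_ (Eventually.of_forall fun w => ?_)
      · exact (hk.comp (continuous_const.sub continuous_id)).aestronglyMeasurable.smul hg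
      · rw [norm_smul]; exact mul_le_mul_of_nonneg_left (hC _) (norm_nonneg _)
    rw [show P (∫ w, k ((z.1, z.2) - w) • g w) (H z) = (P.flip (H z)) (∫ w, k ((z.1, z.2) - w) • g w)
      from by rw [P.flip_apply], ← (P.flip (H z)).integral_comp_comm hint]
    refine integral_congr_ae (Eventually.of_forall fun w => ?_)
    simp only [hG, map_smul, P.flip_apply, FunLike.coe_smul, Pi.smul_apply, smul_eq_mul, Prod.mk.eta]
  simp_rw [hL, hR]
  exact integral_integral_swap hGint

end Adjoint

/-! ### The mollified weak identity -/

section Mollified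

variable {a T ν : ℝ} {u : ℝ → E → E} {k : ℝ × E → ℝ} {r : ℝ}

omit [FiniteDimensional ℝ E] [MeasurableSpace E] [BorelSpace E] in
/-- The spatial gradient field `w ↦ DₓΦ(w)` of a space–time test field is continuous with
compact support. [folklore] -/
theorem continuous_hasCompactSupport_fderiv_field {Φ : ℝ → E → F} (hΦ : ContDiff ℝ ∞ (uncurry Φ))
    (hΦc : HasCompactSupport (uncurry Φ)) :
    Continuous (fun w : ℝ × E => fderiv ℝ (Φ w.1) w.2) ∧
      HasCompactSupport (fun w : ℝ × E => fderiv ℝ (Φ w.1) w.2) := by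
  have hd : ∀ w : ℝ × E, DifferentiableAt ℝ (uncurry Φ) w := fun w => (hΦ.differentiable (by simp)) w
  have hrepr : (fun w : ℝ × E => fderiv ℝ (Φ w.1) w.2) =
      fun w => (fderiv ℝ (uncurry Φ) w).comp (ContinuousLinearMap.inr ℝ ℝ E) := by
    funext w
    exact fderiv_slice (hd w)
  rw [hrepr]
  refine ⟨((ContinuousLinearMap.compL ℝ E (ℝ × E) F).flip (ContinuousLinearMap.inr ℝ ℝ E)).continuous.comp
    (hΦ.continuous_fderiv (by simp)), (hΦc.fderiv ℝ).mono fun w hw h0 => hw ?_⟩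
  change (fderiv ℝ (uncurry Φ) w).comp (ContinuousLinearMap.inr ℝ ℝ E) = 0
  rw [h0, ContinuousLinearMap.zero_comp]

/-- **Operator-valued spatial derivative on the data**:
`Dₓ(κ ⋆ Φ)(t, ·)(x) = (κ ⋆ DₓΦ)(t, x)` in `E →L[ℝ] F` (locally integrable kernel). [folklore] -/
theorem fderiv_stMollify_eq_stMollify_fderiv [CompleteSpace F] {κ : ℝ × E → ℝ}
    (hκ : LocallyIntegrable κ volume) {Φ : ℝ → E → F} (hΦ : ContDiff ℝ ∞ (uncurry Φ))
    (hΦc : HasCompactSupport (uncurry Φ)) (t : ℝ) (x : E) :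
    fderiv ℝ (stMollify κ (uncurry Φ) t) x = stMollify κ (fun w => fderiv ℝ (Φ w.1) w.2) t x := by
  obtain ⟨hGc, hGs⟩ := continuous_hasCompactSupport_fderiv_field hΦ hΦc
  have hint := (hGs.convolutionExists_right (lsmul ℝ ℝ : ℝ →L[ℝ] (E →L[ℝ] F) →L[ℝ] (E →L[ℝ] F))
    hκ hGc (t, x)).integrable
  ext v
  rw [fderiv_stMollify_apply_of_hasCompactSupport hκ hΦ hΦc t x v, stMollify_apply, stMollify_apply,
    convolution_def, convolution_def, ContinuousLinearMap.integral_apply hint v]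
  rfl

omit [MeasurableSpace E] [BorelSpace E] in
/-- The reflected kernel `ǩ(v) = k(−v)` is smooth, vanishes outside the same ball, and is
continuous with compact support. [folklore] -/
theorem reflectKernel_props (hk : ContDiff ℝ ∞ k) (hkr : ∀ w, w ∉ closedBall (0 : ℝ × E) r → k w = 0) :
    ContDiff ℝ ∞ (fun v : ℝ × E => k (-v)) ∧
      (∀ w, w ∉ closedBall (0 : ℝ × E) r → k (-w) = 0) ∧
      HasCompactSupport (fun v : ℝ × E => k (-v)) := by
  have hneg : ∀ w, w ∉ closedBall (0 : ℝ × E) r → k (-w) = 0 := fun w hw =>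
    hkr (-w) (by simpa using hw)
  exact ⟨hk.comp contDiff_neg, hneg, hasCompactSupport_of_closedBall hneg⟩

/-- **The mollified weak identity** (KNSS 2009, §3 p. 7 / §4 (ii): the weak formulation with
solenoidal space–time test fields, tested with the correlated field `ψ = ǩ ⋆ Φ`). Let `u` be a
bounded weak solution on `(a, T) × E` with `‖u‖ ≤ M`, `k` a smooth kernel vanishing outside
`closedBall 0 r`, and `Φ` a smooth compactly supported space–time field with divergence-free
slices, vanishing for times outside `[t₁, t₂]` with `a < t₁ − r`, `t₂ + r < T`. (The bound `M` is an explicit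
argument for bookkeeping of constants downstream; some such `M ≥ 0` always exists by
`hu.isBoundedOn`.) Then with `V = k ⋆ 𝟙_Q u` and `W = k ⋆ 𝟙_Q (u ⊗ u)`:
`∫ (⟪V, ∂ₜΦ⟫ + frobeniusPairing E (DₓΦ) W + ν ⟪V, ΔₓΦ⟫) dz = 0`. [cite: KochNadirashviliSereginSverak2009, §3 p. 7 and §4 (ii) p. 8 (arXiv:0709.3599v1)] -/
theorem IsBoundedWeakNSSolutionOn.integral_mollified_eq_zero
    (hu : IsBoundedWeakNSSolutionOn (Ioo a T) isOpen_Ioo ν u) {M : ℝ} (hM0 : 0 ≤ M)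
    (hM : ∀ t ∈ Ioo a T, ∀ x, ‖u t x‖ ≤ M) (hk : ContDiff ℝ ∞ k)
    (hkr : ∀ w, w ∉ closedBall (0 : ℝ × E) r → k w = 0) {Φ : ℝ → E → E}
    (hΦ : ContDiff ℝ ∞ (uncurry Φ)) (hΦc : HasCompactSupport (uncurry Φ))
    (hdiv : ∀ s, VectorCalculus.IsDivFree (Φ s)) {t₁ t₂ : ℝ}
    (hΦt : ∀ s, s ∉ Icc t₁ t₂ → ∀ y, Φ s y = 0) (ha : a < t₁ - r) (hT : t₂ + r < T) :
    ∫ z : ℝ × E, (⟪stMollify k (zeroExt (slab E (Ioo a T) isOpen_Ioo) u) z.1 z.2, timeDeriv Φ z.1 z.2⟫ +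
      frobeniusPairing E (fderiv ℝ (Φ z.1) z.2) (stMollify k (zeroExt (slab E (Ioo a T) isOpen_Ioo) (dyadField u)) z.1 z.2) +
      ν * ⟪stMollify k (zeroExt (slab E (Ioo a T) isOpen_Ioo) u) z.1 z.2, (Δ (Φ z.1)) z.2⟫) = 0 := by
  set Q : Opens (ℝ × E) := slab E (Ioo a T) isOpen_Ioo with hQdef
  have hQm : MeasurableSet (Q : Set (ℝ × E)) := Q.isOpen.measurableSet
  -- the kernels
  obtain ⟨hkn, hknr, hknc⟩ := reflectKernel_props hk hkr
  have hkc : HasCompactSupport k := hasCompactSupport_of_closedBall hkr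
  have hknl : LocallyIntegrable (fun v : ℝ × E => k (-v)) volume := hkn.continuous.locallyIntegrable
  -- the fields `uz`, `R̃` and their bounds
  set uz : ℝ × E → E := zeroExt Q u with huz
  set R : ℝ × E → E →L[ℝ] E := zeroExt Q (dyadField u) with hR
  have huzm : AEStronglyMeasurable uz volume := (aestronglyMeasurable_indicator_iff hQm).2 hu.aestronglyMeasurable
  have hRm : AEStronglyMeasurable R volume := by
    refine (aestronglyMeasurable_indicator_iff hQm).2 ?_
    exact continuous_rankOne_self.comp_aestronglyMeasurable hu.aestronglyMeasurable
  have huzb : ∀ w, ‖uz w‖ ≤ M := fun w => by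
    by_cases hw : w ∈ (Q : Set (ℝ × E))
    · rw [huz, zeroExt_of_mem _ hw]; exact hM w.1 (mem_slab.1 hw) w.2
    · rw [huz, zeroExt_of_not_mem _ hw, norm_zero]; exact hM0
  have hRb : ∀ w, ‖R w‖ ≤ M ^ 2 := fun w => by
    by_cases hw : w ∈ (Q : Set (ℝ × E))
    · rw [hR, zeroExt_of_mem _ hw, dyadField, norm_rankOne, ← sq]
      exact pow_le_pow_left₀ (norm_nonneg _) (hM w.1 (mem_slab.1 hw) w.2) 2
    · rw [hR, zeroExt_of_not_mem _ hw, norm_zero]; positivity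
  -- the test field `ψ = ǩ ⋆ Φ` and its derivatives
  set ψ : ℝ → E → E := stMollify (fun v => k (-v)) (uncurry Φ) with hψdef
  obtain ⟨hψ, -⟩ := isSpaceTimeTestOn_stMollify_of_time_support hkn.continuous hknr hΦ hΦc hΦt ha hT
  have hψdiv : ∀ s, VectorCalculus.IsDivFree (ψ s) := isDivFree_stMollify_of_hasCompactSupport hknl hΦ hΦc hdiv
  have key := hu.integral_eq_zero hψ hψdiv
  -- the three data fields `∂ₜΦ`, `DₓΦ`, `ΔₓΦ`: continuous with compact support
  set b := stdOrthonormalBasis ℝ E with hb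
  obtain ⟨hTcd, hTs⟩ := contDiff_hasCompactSupport_timeDeriv hΦ hΦc
  have hTc := hTcd.continuous
  obtain ⟨hGc, hGs⟩ := continuous_hasCompactSupport_fderiv_field hΦ hΦc
  set T₁ : ℝ × E → E := uncurry (timeDeriv Φ) with hT₁
  set G : ℝ × E → E →L[ℝ] E := fun w => fderiv ℝ (Φ w.1) w.2 with hG
  set L₁ : ℝ × E → E := uncurry fun s y => (Δ (Φ s)) y with hL₁
  have hΦs : ∀ s, ContDiff ℝ 2 (Φ s) := fun s => contDiff_infty.1 (contDiff_slice hΦ s) 2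
  have hLrepr : L₁ = fun w => ∑ i, uncurry (fun s y =>
      fderiv ℝ (fun y' => fderiv ℝ (Φ s) y' (b i)) y (b i)) w := by
    funext w
    change (Δ (Φ w.1)) w.2 = ∑ i, fderiv ℝ (fun y' => fderiv ℝ (Φ w.1) y' (b i)) w.2 (b i)
    rw [laplacian_eq_iteratedFDeriv_orthonormalBasis (Φ w.1) b]
    exact Finset.sum_congr rfl fun i _ => iteratedFDeriv_two_apply_self (hΦs w.1) w.2 (b i)
  have hsec : ∀ i, ContDiff ℝ ∞ (uncurry fun s y => fderiv ℝ (fun y' => fderiv ℝ (Φ s) y' (b i)) y (b i)) ∧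
      HasCompactSupport (uncurry fun s y => fderiv ℝ (fun y' => fderiv ℝ (Φ s) y' (b i)) y (b i)) :=
    fun i => by
    obtain ⟨hc, hcs⟩ := contDiff_hasCompactSupport_fderiv_slice hΦ hΦc (b i)
    exact contDiff_hasCompactSupport_fderiv_slice hc hcs (b i)
  have hLc : Continuous L₁ := by
    rw [hLrepr]; exact continuous_finsetSum _ fun i _ => (hsec i).1.continuous
  have hLs : HasCompactSupport L₁ := by
    rw [hLrepr]
    refine HasCompactSupport.intro (isCompact_iUnion fun i => (hsec i).2) fun w hw => ?_
    refine Finset.sum_eq_zero fun i _ => image_eq_zero_of_notMem_tsupport fun h => hw ?_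
    exact mem_iUnion.2 ⟨i, h⟩
  -- the mollified test data are continuous with compact support
  have hψTc : Continuous (uncurry (stMollify (fun v => k (-v)) T₁)) :=
    hTs.continuous_convolution_right (lsmul ℝ ℝ) hknl hTc
  have hψTs : HasCompactSupport (uncurry (stMollify (fun v => k (-v)) T₁)) :=
    hknc.convolution (lsmul ℝ ℝ) hTs
  have hψGc : Continuous (uncurry (stMollify (fun v => k (-v)) G)) :=
    hGs.continuous_convolution_right (lsmul ℝ ℝ) hknl hGc
  have hψGs : HasCompactSupport (uncurry (stMollify (fun v => k (-v)) G)) :=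
    hknc.convolution (lsmul ℝ ℝ) hGs
  have hψLc : Continuous (uncurry (stMollify (fun v => k (-v)) L₁)) :=
    hLs.continuous_convolution_right (lsmul ℝ ℝ) hknl hLc
  have hψLs : HasCompactSupport (uncurry (stMollify (fun v => k (-v)) L₁)) :=
    hknc.convolution (lsmul ℝ ℝ) hLs
  -- the weak integrand, rewritten through the test data
  set kn : ℝ × E → ℝ := fun v => k (-v) with hkn_def
  set F₀ : ℝ → E → ℝ := fun t x =>
    ⟪u t x, stMollify kn T₁ t x⟫ + frobeniusPairing E (stMollify kn G t x) (rankOne ℝ (u t x) (u t x)) +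
      ν * ⟪u t x, stMollify kn L₁ t x⟫ with hF₀
  have hpt : ∀ t x, ⟪u t x, timeDeriv ψ t x⟫ + ⟪u t x, convect (u t) (ψ t) x⟫ + ν * ⟪u t x, (Δ (ψ t)) x⟫ =
      F₀ t x := by
    intro t x
    have e1 : timeDeriv ψ t x = stMollify kn T₁ t x := timeDeriv_stMollify_of_hasCompactSupport hknl hΦ hΦc t x
    have e2 : convect (u t) (ψ t) x = stMollify kn G t x (u t x) := by
      rw [convect, hψdef, fderiv_stMollify_eq_stMollify_fderiv hknl hΦ hΦc]
    have e3 : (Δ (ψ t)) x = stMollify kn L₁ t x := laplacian_stMollify_of_hasCompactSupport hknl hΦ hΦc t x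
    rw [e1, e2, e3, ← frobeniusPairing_rankOne_self]
  -- integrability of the rewritten integrand on the slab
  have hum : AEStronglyMeasurable (fun z : ℝ × E => u z.1 z.2) (volume.restrict (Q : Set (ℝ × E))) :=
    hu.aestronglyMeasurable
  have hbdE : ∀ {Hm : ℝ × E → E}, Continuous Hm → HasCompactSupport Hm →
      Integrable (fun z => ‖Hm z‖) (volume.restrict (Q : Set (ℝ × E))) := fun hc hs =>
    ((hc.integrable_of_hasCompactSupport hs).norm).integrableOn
  have hbdL : ∀ {Hm : ℝ × E → E →L[ℝ] E}, Continuous Hm → HasCompactSupport Hm →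
      Integrable (fun z => ‖Hm z‖) (volume.restrict (Q : Set (ℝ × E))) := fun hc hs =>
    ((hc.integrable_of_hasCompactSupport hs).norm).integrableOn
  have hTP : Continuous (uncurry fun (L : E →L[ℝ] E) (T : E →L[ℝ] E) => frobeniusPairing E L T) :=
    (frobeniusPairing E).continuous₂
  obtain ⟨CP, hCP0, hCP⟩ := exists_norm_frobeniusPairing_le (E := E)
  have hIP : Continuous (uncurry fun (v w : E) => ⟪v, w⟫) := continuous_inner
  have hint0 : IntegrableOn (fun z : ℝ × E => F₀ z.1 z.2) (Q : Set (ℝ × E)) volume := by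
    have i1 : IntegrableOn (fun z : ℝ × E => ⟪u z.1 z.2, stMollify kn T₁ z.1 z.2⟫) (Q : Set (ℝ × E)) volume := by
      refine Integrable.mono' ((hbdE hψTc hψTs).const_mul M)
        (hIP.comp_aestronglyMeasurable₂ hum hψTc.aestronglyMeasurable) ?_
      filter_upwards [ae_restrict_mem hQm] with z hz
      exact (norm_inner_le_norm _ _).trans (mul_le_mul_of_nonneg_right (hM z.1 (mem_slab.1 hz) z.2) (norm_nonneg _))
    have i2 : IntegrableOn (fun z : ℝ × E => frobeniusPairing E (stMollify kn G z.1 z.2) (rankOne ℝ (u z.1 z.2) (u z.1 z.2)))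
        (Q : Set (ℝ × E)) volume := by
      refine Integrable.mono' ((hbdL hψGc hψGs).const_mul (CP * M ^ 2))
        (hTP.comp_aestronglyMeasurable₂ hψGc.aestronglyMeasurable
          (continuous_rankOne_self.comp_aestronglyMeasurable hum)) ?_
      filter_upwards [ae_restrict_mem hQm] with z hz
      refine (hCP _ _).trans ?_
      have h1 : ‖rankOne ℝ (u z.1 z.2) (u z.1 z.2)‖ ≤ M ^ 2 := by
        rw [norm_rankOne, ← sq]
        exact pow_le_pow_left₀ (norm_nonneg _) (hM z.1 (mem_slab.1 hz) z.2) 2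
      calc CP * ‖stMollify kn G z.1 z.2‖ * ‖rankOne ℝ (u z.1 z.2) (u z.1 z.2)‖
          ≤ CP * ‖stMollify kn G z.1 z.2‖ * M ^ 2 := by gcongr
        _ = CP * M ^ 2 * ‖stMollify kn G z.1 z.2‖ := by ring
    have i3 : IntegrableOn (fun z : ℝ × E => ν * ⟪u z.1 z.2, stMollify kn L₁ z.1 z.2⟫) (Q : Set (ℝ × E)) volume := by
      refine (Integrable.mono' ((hbdE hψLc hψLs).const_mul M)
        (hIP.comp_aestronglyMeasurable₂ hum hψLc.aestronglyMeasurable) ?_).const_mul ν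
      filter_upwards [ae_restrict_mem hQm] with z hz
      exact (norm_inner_le_norm _ _).trans (mul_le_mul_of_nonneg_right (hM z.1 (mem_slab.1 hz) z.2) (norm_nonneg _))
    exact (i1.add i2).add i3
  -- the weak identity as a whole-space integral of the zero-extended integrand
  set Fz : ℝ × E → ℝ := fun z =>
    ⟪uz z, stMollify kn T₁ z.1 z.2⟫ + frobeniusPairing E (stMollify kn G z.1 z.2) (R z) +
      ν * ⟪uz z, stMollify kn L₁ z.1 z.2⟫ with hFz
  have hFz_ind : Fz = (Q : Set (ℝ × E)).indicator fun z => F₀ z.1 z.2 := by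
    funext z
    by_cases hz : z ∈ (Q : Set (ℝ × E))
    · rw [indicator_of_mem hz]
      have hu1 : uz z = u z.1 z.2 := zeroExt_of_mem _ hz
      have hR1 : R z = rankOne ℝ (u z.1 z.2) (u z.1 z.2) := zeroExt_of_mem _ hz
      simp only [hFz, hF₀, hu1, hR1]
    · rw [indicator_of_notMem hz]
      have hu1 : uz z = 0 := zeroExt_of_not_mem _ hz
      have hR1 : R z = 0 := zeroExt_of_not_mem _ hz
      simp only [hFz, hu1, hR1, inner_zero_left, map_zero, mul_zero, add_zero]
  have hkey : ∫ z, Fz z = 0 := by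
    rw [hFz_ind, integral_indicator hQm]
    have hprod : ∫ z in (Q : Set (ℝ × E)), F₀ z.1 z.2 = ∫ t in Ioo a T, ∫ x, F₀ t x := by
      rw [show ((Q : Opens (ℝ × E)) : Set (ℝ × E)) = Ioo a T ×ˢ univ from rfl,
        show (volume : Measure (ℝ × E)) = (volume : Measure ℝ).prod volume from rfl,
        setIntegral_prod _ hint0]
      simp only [Measure.restrict_univ]
    rw [hprod, ← key]
    exact setIntegral_congr_fun measurableSet_Ioo fun t _ => integral_congr_ae
      (Eventually.of_forall fun x => (hpt t x).symm)
  -- split and apply the adjoint identity to each term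
  have j1 : Integrable (fun z : ℝ × E => ⟪uz z, stMollify kn T₁ z.1 z.2⟫) := by
    refine Integrable.mono' ((hψTc.integrable_of_hasCompactSupport hψTs).norm.const_mul M)
      (hIP.comp_aestronglyMeasurable₂ huzm hψTc.aestronglyMeasurable) (Eventually.of_forall fun z => ?_)
    exact (norm_inner_le_norm _ _).trans (mul_le_mul_of_nonneg_right (huzb z) (norm_nonneg _))
  have j2 : Integrable (fun z : ℝ × E => frobeniusPairing E (stMollify kn G z.1 z.2) (R z)) := by
    refine Integrable.mono' ((hψGc.integrable_of_hasCompactSupport hψGs).norm.const_mul (CP * M ^ 2))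
      (hTP.comp_aestronglyMeasurable₂ hψGc.aestronglyMeasurable hRm) (Eventually.of_forall fun z => ?_)
    refine (hCP _ _).trans ?_
    calc CP * ‖stMollify kn G z.1 z.2‖ * ‖R z‖
        ≤ CP * ‖stMollify kn G z.1 z.2‖ * M ^ 2 := by gcongr; exact hRb z
      _ = CP * M ^ 2 * ‖stMollify kn G z.1 z.2‖ := by ring
  have j3 : Integrable (fun z : ℝ × E => ⟪uz z, stMollify kn L₁ z.1 z.2⟫) := by
    refine Integrable.mono' ((hψLc.integrable_of_hasCompactSupport hψLs).norm.const_mul M)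
      (hIP.comp_aestronglyMeasurable₂ huzm hψLc.aestronglyMeasurable) (Eventually.of_forall fun z => ?_)
    exact (norm_inner_le_norm _ _).trans (mul_le_mul_of_nonneg_right (huzb z) (norm_nonneg _))
  have hsplit : ∫ z, Fz z = (∫ z, ⟪uz z, stMollify kn T₁ z.1 z.2⟫) +
      (∫ z, frobeniusPairing E (stMollify kn G z.1 z.2) (R z)) + ν * ∫ z, ⟪uz z, stMollify kn L₁ z.1 z.2⟫ := by
    have h12 := integral_add j1 j2
    have h123 := integral_add (j1.add j2) (j3.const_mul ν)
    simp only [Pi.add_apply] at h123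
    rw [MeasureTheory.integral_const_mul, h12] at h123
    exact h123
  have hA : ∫ z, ⟪uz z, stMollify kn T₁ z.1 z.2⟫ = ∫ z, ⟪stMollify k uz z.1 z.2, T₁ z⟫ :=
    integral_pair_stMollify_neg_eq (innerSL ℝ) hk.continuous hkc huzm huzb hTc hTs
  have hB : ∫ z, frobeniusPairing E (stMollify kn G z.1 z.2) (R z) = ∫ z, frobeniusPairing E (G z) (stMollify k R z.1 z.2) :=
    integral_pair_stMollify_neg_eq (frobeniusPairing E).flip hk.continuous hkc hRm hRb hGc hGs
  have hC : ∫ z, ⟪uz z, stMollify kn L₁ z.1 z.2⟫ = ∫ z, ⟪stMollify k uz z.1 z.2, L₁ z⟫ :=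
    integral_pair_stMollify_neg_eq (innerSL ℝ) hk.continuous hkc huzm huzb hLc hLs
  rw [hA, hB, hC] at hsplit
  -- reassemble
  have hVc : Continuous (uncurry (stMollify k uz)) :=
    (hkc.contDiff_convolution_left (lsmul ℝ ℝ) hk
      ((memLp_top_of_bound huzm M (Eventually.of_forall huzb)).locallyIntegrable le_top)).continuous
  have hWc : Continuous (uncurry (stMollify k R)) :=
    (hkc.contDiff_convolution_left (lsmul ℝ ℝ) hk
      ((memLp_top_of_bound hRm (M ^ 2) (Eventually.of_forall hRb)).locallyIntegrable le_top)).continuous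
  have hsupp_inner : ∀ {Hm : ℝ × E → E}, HasCompactSupport Hm →
      HasCompactSupport fun z : ℝ × E => ⟪stMollify k uz z.1 z.2, Hm z⟫ := fun hs =>
    hs.mono fun z hz h0 => hz (by change ⟪stMollify k uz z.1 z.2, _⟫ = 0; rw [h0, inner_zero_right])
  have l1 : Integrable (fun z : ℝ × E => ⟪stMollify k uz z.1 z.2, T₁ z⟫) :=
    (hIP.comp₂ hVc hTc).integrable_of_hasCompactSupport (hsupp_inner hTs)
  have l2 : Integrable (fun z : ℝ × E => frobeniusPairing E (G z) (stMollify k R z.1 z.2)) := by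
    refine (hTP.comp₂ hGc hWc).integrable_of_hasCompactSupport (hGs.mono fun z hz h0 => hz ?_)
    change frobeniusPairing E (G z) (stMollify k R z.1 z.2) = 0
    rw [h0, map_zero]; rfl
  have l3 : Integrable (fun z : ℝ × E => ⟪stMollify k uz z.1 z.2, L₁ z⟫) :=
    (hIP.comp₂ hVc hLc).integrable_of_hasCompactSupport (hsupp_inner hLs)
  have hfinal : ∫ z : ℝ × E, (⟪stMollify k uz z.1 z.2, timeDeriv Φ z.1 z.2⟫ +
        frobeniusPairing E (fderiv ℝ (Φ z.1) z.2) (stMollify k R z.1 z.2) + ν * ⟪stMollify k uz z.1 z.2, (Δ (Φ z.1)) z.2⟫)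
      = (∫ z, ⟪stMollify k uz z.1 z.2, T₁ z⟫) + (∫ z, frobeniusPairing E (G z) (stMollify k R z.1 z.2)) +
          ν * ∫ z, ⟪stMollify k uz z.1 z.2, L₁ z⟫ := by
    have h12 := integral_add l1 l2
    have h123 := integral_add (l1.add l2) (l3.const_mul ν)
    simp only [Pi.add_apply] at h123
    rw [MeasureTheory.integral_const_mul, h12] at h123
    exact h123
  rw [hfinal, ← hsplit, hkey]

/-! ### Mollifications of bounded data: global bounds and smoothness -/

/-- **Sup bound of a mollification of bounded data**: `‖(κ ⋆ g)(t, x)‖ ≤ (∫ ‖κ‖) C` when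
`‖g‖ ≤ C` and `κ` is integrable. [folklore] -/
theorem norm_stMollify_le_of_bound {κ : ℝ × E → ℝ} (hκ : Integrable κ (volume : Measure (ℝ × E)))
    {X : Type*} [NormedAddCommGroup X] [NormedSpace ℝ X] {g : ℝ × E → X} {C : ℝ}
    (hC : ∀ w, ‖g w‖ ≤ C) (t : ℝ) (x : E) :
    ‖stMollify κ g t x‖ ≤ (∫ w, ‖κ w‖) * C := by
  rw [stMollify_eq_integral]
  have hC0 : 0 ≤ C := (norm_nonneg _).trans (hC 0)
  have hi : Integrable (fun w : ℝ × E => ‖κ ((t, x) - w)‖ * C) volume :=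
    ((hκ.comp_sub_left (t, x)).norm).mul_const C
  calc ‖∫ w, κ ((t, x) - w) • g w‖ ≤ ∫ w, ‖κ ((t, x) - w)‖ * C := by
        refine norm_integral_le_of_norm_le hi (Eventually.of_forall fun w => ?_)
        rw [norm_smul]; exact mul_le_mul_of_nonneg_left (hC w) (norm_nonneg _)
    _ = (∫ w, ‖κ ((t, x) - w)‖) * C := integral_mul_const _ _
    _ = (∫ w, ‖κ w‖) * C := by rw [integral_sub_left_eq_self (fun w => ‖κ w‖) volume (t, x)]

end Mollified

end Literature.Analysis.FluidPDE

end
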